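/-
[OURS · L1 W4.5(b) · EL♮(3)] SPECIMEN-TC⁺ (quartic, one inner step (i)) — the LOCAL INNER TWO-STEP REGULARITY on `Spec DL`.
-/
import Summits.ResolutionOfSingularities.ResolutionOfSingularities.Theorems.EquisingularLiftEquisingularLiftNatSpecimenQuarticTcPlusInnerLocalCharts
import HarnessLib

/-!
# [OURS · L1 W4.5(b) · EL♮(3)] SPECIMEN-TC⁺ for the quartic — part L2: the LOCAL INNER TWO-STEP REGULARITY
# (crux `EquisingularLiftNatThree` = stmt-ResolutionOfSingularities-20148; res-L1-w45b-lead-2 DEALS (D2) 2026-08-27T11:55:26Z «NON-VACUITY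
# CERTIFICATES TC⁺»; scoping memo D/res-D-pv-034/SPECIMEN-TCPLUS-SCOPE.md §1/§5; helper, closes nothing)

HONEST FRAMING. OURS (cell `res-hironaka`, chain w45b, slot W4.5(b)); NOT a statement of any manuscript; AI-written, weaker than expert review.

THE STATEMENT (`isRegular_innerTwoStep`). `DL = k[y₀,y₁,y₂]/(y₂² + y₁²(1 + y₀⁴))` (`2 ∈ kˣ`), `ptL` its origin, `V(cenL) = V(ȳ₁, ȳ₂)` the carrier
line. For EVERY blow-up `ρa : B₁ → Spec DL` at `𝔪₀~` and EVERY blow-up `ρb : B₂ → B₁` along the ideal sheaf of the reduced closed set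
`closure (ρa⁻¹ (V(cenL) ∖ {ptL}))` (the strict transform of the line), `B₂` is REGULAR. This is the local form, over the `x`-chart of the first
point step, of «one in-carrier point step (i) at a regular carrier point, then the carrier curve» in the TC⁺ closure of the registered stub
`stub_elnat_tcPlusPointResolution`.

PROOF. Stacks-0804 charts `Spec DL[𝔪₀/ȳⱼ]` of `ρa` (`IsBlowup.exists_chart_of_span_range_eq`); the centre of `ρb` pulls back to the ideal sheaf
of `closure (V(cenL · DL[𝔪₀/ȳⱼ]) ∖ V(ȳⱼ/1))` (`…TcPlusInnerLocalCharts`): EMPTY for `j = 1, 2` (so `ρb` is an isomorphism onto the regular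
`Spec DL[𝔪₀/ȳⱼ]`, `isRegularRing_BchL₁/₂`), and `V(ε cenL)` for `j = 0` (self-similar chart `ε : DL ≅ DL[𝔪₀/ȳ₀]`), where the charts of `ρb`
are the regular line-step rings (`isRegularRing_lineChart_map'`).

References: The Stacks Project, Tags 0804, 080E; Görtz–Wedhorn I (13.19), Prop. 13.91, Prop. 13.96 (2).
-/

set_option linter.dupNamespace false -- mandated namespace `Summit.<Summit>.<Problem>` of this single-conjunct summit

noncomputable section

open CategoryTheory CategoryTheory.Limits AlgebraicGeometry TopologicalSpace
open MvPolynomial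
open Literature.AlgebraicGeometry.Resolution
open AlgebraicGeometry.Scheme.IdealSheafData
open Summit.ResolutionOfSingularities.ResolutionOfSingularities.Theorems.EquisingularLift

namespace Summit.ResolutionOfSingularities.ResolutionOfSingularities.Cruxes.EquisingularLiftNat.Sections

namespace SpecimenQuarticTcPlus

open SpecimenQuarticTcDelta

universe u

variable (k : Type) [Field k]

/-- **The second centre read on a chart of the first blow-up**: along an open immersion `φ : Spec DL[𝔪₀/ȳⱼ] → B₁` over `Spec DL`, the ideal
sheaf of the reduced strict transform of the carrier line pulls back to the ideal sheaf of `closure (V(cenL · DL[𝔪₀/ȳⱼ]) ∖ V(ȳⱼ/1))`.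
[cite: StacksProject, Tag 080E] -/
theorem comap_vanishingIdeal_lineStrict {B₁ : Scheme.{0}} {ρa : B₁ ⟶ Spec (CommRingCat.of (DL k))} (j : Fin 3)
    {φ : Spec (CommRingCat.of (BchL k j)) ⟶ B₁} [IsOpenImmersion φ]
    (hφ : φ ≫ ρa = Spec.map (CommRingCat.ofHom (algebraMap (DL k) (BchL k j)))) :
    (vanishingIdeal (⟨closure (ρa ⁻¹' (PrimeSpectrum.zeroLocus (cenL k : Set (DL k)) \ {ptL k})), isClosed_closure⟩ : Closeds B₁)).comap φ =
      vanishingIdeal (⟨closure (PrimeSpectrum.zeroLocus (((cenL k).map (algebraMap (DL k) (BchL k j))) : Set (BchL k j)) \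
        PrimeSpectrum.zeroLocus {excL k j}), isClosed_closure⟩ : Closeds (Spec (CommRingCat.of (BchL k j)))) := by
  rw [comap_vanishingIdeal_of_isOpenImmersion]
  congr 1
  apply Closeds.ext
  change φ ⁻¹' closure (ρa ⁻¹' (PrimeSpectrum.zeroLocus (cenL k : Set (DL k)) \ {ptL k})) =
    closure (PrimeSpectrum.zeroLocus (((cenL k).map (algebraMap (DL k) (BchL k j))) : Set (BchL k j)) \
      PrimeSpectrum.zeroLocus {excL k j})
  rw [φ.isOpenEmbedding.isOpenMap.preimage_closure_eq_closure_preimage φ.continuous, Set.preimage_sdiff, Set.preimage_sdiff]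
  erw [preimage_chart_preimage_zeroLocus k j hφ (cenL k), preimage_chart_preimage_ptF k (gL_mem_originIdeal k) j hφ]
  rfl

/-- **LOCAL INNER TWO-STEP REGULARITY.** For every blow-up `ρa : B₁ → Spec DL` at the origin and every blow-up `ρb : B₂ → B₁` along the ideal
sheaf of the REDUCED strict transform `closure (ρa⁻¹ (V(ȳ₁, ȳ₂) ∖ {ptL}))` of the carrier line, `B₂` is regular (`char k ≠ 2`).
[OURS · L1 W4.5b · SPECIMEN-TC⁺ (i)] [cite: StacksProject, Tag 0804] -/
theorem isRegular_innerTwoStep (h2 : IsUnit (2 : k))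
    {B₁ B₂ : Scheme.{0}} (ρa : B₁ ⟶ Spec (CommRingCat.of (DL k)))
    (hρa : IsBlowup ρa (ofIdealTop ((mbarL k).map (Scheme.ΓSpecIso (CommRingCat.of (DL k))).inv.hom)))
    (ρb : B₂ ⟶ B₁)
    (hρb : IsBlowup ρb (vanishingIdeal (⟨closure (ρa ⁻¹' (PrimeSpectrum.zeroLocus (cenL k : Set (DL k)) \ {ptL k})),
      isClosed_closure⟩ : Closeds B₁))) :
    Scheme.IsRegular B₂ := by
  intro z
  obtain ⟨j, φ, hφoi, ⟨w, hw⟩, hφ⟩ := IsBlowup.exists_chart_of_span_range_eq hρa (gbarL k) (by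
    rw [show gbarL k = gbarF k (gL k) from rfl, span_range_gbarF]) (ρb z)
  -- the chart as an open `U` of `B₁`, `e : Spec DL[𝔪₀/ȳⱼ] ≅ U`
  let U : B₁.Opens := φ.opensRange
  have hzU : ρb z ∈ U := ⟨w, hw⟩
  have hrange : Set.range φ = Set.range U.ι := by
    rw [Scheme.Opens.range_ι]; rfl
  let e := IsOpenImmersion.isoOfRangeEq φ U.ι hrange
  have he : e.hom ≫ U.ι = φ := IsOpenImmersion.isoOfRangeEq_hom_fac _ _ _
  -- the restricted second blow-up, moved to `Spec DL[𝔪₀/ȳⱼ]`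
  have hρbU : IsBlowup ((ρb ∣_ U) ≫ e.symm.hom)
      (vanishingIdeal (⟨closure (PrimeSpectrum.zeroLocus (((cenL k).map (algebraMap (DL k) (BchL k j))) : Set (BchL k j)) \
        PrimeSpectrum.zeroLocus {excL k j}), isClosed_closure⟩ : Closeds (Spec (CommRingCat.of (BchL k j))))) := by
    have h := (hρb.restrict U).comp_iso e.symm
    rw [← Scheme.IdealSheafData.comap_comp, Iso.symm_inv, he, comap_vanishingIdeal_lineStrict k j hφ] at h
    exact h
  -- name the pulled-back centre `C` (so that later identifications rewrite a variable)
  obtain ⟨C, hρbC, hC⟩ : ∃ C : Closeds (Spec (CommRingCat.of (BchL k j))), IsBlowup ((ρb ∣_ U) ≫ e.symm.hom) (vanishingIdeal C) ∧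
      (C : Set (Spec (CommRingCat.of (BchL k j)))) =
        closure (PrimeSpectrum.zeroLocus (((cenL k).map (algebraMap (DL k) (BchL k j))) : Set (BchL k j)) \
          PrimeSpectrum.zeroLocus {excL k j}) := ⟨_, hρbU, rfl⟩
  clear hρbU
  -- the stalk of `B₂` at `z` is the stalk of `ρb⁻¹ U` at `⟨z, _⟩`
  suffices hst : IsRegularLocalRing ((↑(ρb ⁻¹ᵁ U) : Scheme.{0}).presheaf.stalk ⟨z, hzU⟩) from by
    haveI := hst
    exact IsRegularLocalRing.of_ringEquiv (asIso ((ρb ⁻¹ᵁ U).ι.stalkMap ⟨z, hzU⟩)).commRingCatIsoToRingEquiv.symm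
  -- on a chart where the centre is empty and the chart ring is regular, `ρb` is an isomorphism onto a regular scheme
  have hempty : ∀ (hS : PrimeSpectrum.zeroLocus (((cenL k).map (algebraMap (DL k) (BchL k j))) : Set (BchL k j)) \
        PrimeSpectrum.zeroLocus {excL k j} = ∅) (hreg : IsRegularRing (BchL k j)),
      IsRegularLocalRing ((↑(ρb ⁻¹ᵁ U) : Scheme.{0}).presheaf.stalk ⟨z, hzU⟩) := by
    intro hS hreg
    have hCbot : C = ⊥ := Closeds.ext (hC.trans ((closure_empty_iff _).mpr hS))
    rw [hCbot, vanishingIdeal_bot] at hρbC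
    haveI : IsIso ((ρb ∣_ U) ≫ e.symm.hom) := hρbC.isIso isEffectiveCartier_top
    haveI := hreg
    haveI : IsRegularLocalRing ((Spec (CommRingCat.of (BchL k j))).presheaf.stalk (((ρb ∣_ U) ≫ e.symm.hom) ⟨z, hzU⟩)) :=
      Scheme.isRegular_Spec (CommRingCat.of (BchL k j)) _
    exact IsRegularLocalRing.of_ringEquiv
      (R := (Spec (CommRingCat.of (BchL k j))).presheaf.stalk (((ρb ∣_ U) ≫ e.symm.hom) ⟨z, hzU⟩))
      (asIso (((ρb ∣_ U) ≫ e.symm.hom).stalkMap ⟨z, hzU⟩)).commRingCatIsoToRingEquiv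
  -- case analysis on the chart
  have hj : j = 0 ∨ j = 1 ∨ j = 2 := by fin_cases j <;> simp
  rcases hj with rfl | rfl | rfl
  · -- `ȳ₀`-chart: the centre is `V(ε cenL)`; the charts of `ρb` are the regular line-step rings
    obtain ⟨ε, hε0, hε1, hε2⟩ := exists_innerChart₀_equiv_track k
    have hC0 : C = ⟨PrimeSpectrum.zeroLocus (((cenL k).map ε.toRingHom) : Set (BchL k 0)), PrimeSpectrum.isClosed_zeroLocus _⟩ :=
      Closeds.ext (hC.trans (closure_centre_chart₀ k ε hε0 hε1 hε2))
    rw [hC0, vanishingIdeal_centre_chart₀ k ε] at hρbC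
    obtain ⟨i, ψ, hψoi, ⟨w', hw'⟩, -⟩ := IsBlowup.exists_chart_of_span_range_eq hρbC
      (fun i : Fin 2 => ε.toRingHom (Ideal.Quotient.mk (Ideal.span {gL k}) (WhitneyCubic.cen k i)))
      (map_cenL_eq_span_range' k ε.toRingHom).symm ⟨z, hzU⟩
    have hreg := isRegularRing_lineChart_map' k h2 ε i
    by_contra hz
    rw [← hw'] at hz
    exact not_isRegularLocalRing_localization_of_stalk ψ w' hz (hreg.isRegularLocalRing_localization _)
  · exact hempty (centre_chart₁_eq_empty k) (isRegularRing_BchL₁ k h2)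
  · exact hempty (centre_chart₂_eq_empty k) (isRegularRing_BchL₂ k h2)

end SpecimenQuarticTcPlus

end Summit.ResolutionOfSingularities.ResolutionOfSingularities.Cruxes.EquisingularLiftNat.Sections
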